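import Literature.AlgebraicGeometry.GroupSchemes.BTGroupRingActionCompletion          -- ★ `IsRingActionBT.homOfCompatibleFamily{,_app,_idem}`, `app_comm`, `app_eq_app_of_sub_mem_span_pow`
import Literature.AlgebraicGeometry.GroupSchemes.BarsottiTateGroupFixedPartCotangent   -- ★ DEAL 1 `BTGroup.Hom.isRingActionBT_fixRestrict` (+ `fixRestrict`, `comp_fixBTGroupι_injective`)
import Mathlib.RingTheory.Localization.AtPrime.Basic
import Mathlib.RingTheory.Localization.Ideal
import HarnessLib

/-!
# The `w`-block of a Barsotti–Tate group with a ring action: layers killed `w`-adically, units away from `w` invertible, and the action of the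
# local ring `R_w` ([Tate 1967] §2 (2.1)–(2.2); [Rapoport–Smithling–Zhang 2020] §4.1; [Harris–Taylor 2001] §II.1)

Topic `Literature/AlgebraicGeometry/GroupSchemes`; namespace `Literature.AlgebraicGeometry.GroupSchemes.IsRingActionBT`.  THEOREMS ONLY; no definition, no
named fact, no instance, no notation, no `sorry`.  Cell `hodgecm-mathlib` (D-0151), P6 «MOD programme», K∕BT desk F0P6d-plan (g2), K∕BT CUT v2.1 «THE
`w`-BLOCK WITHOUT COMPLETIONS» organ (O-LOC) (memo `F0/P6/F0P6d-plan/KBT-CUT.v2p1.F0P6dplan-g2.md`).  The number theory (a CRT idempotent family `a` at a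
prime `w ∣ p` of `𝓞_F`, inverse families for `s ∉ w`, `w^{e n} · a_n ⊆ (pⁿ)`) is ★ (O-CRT) `RingTheory/DedekindDomain/BlockIdempotentFamily` and enters here
ONLY AS HYPOTHESES on the family, so the two files are import-disjoint.  HC_CM is proved only modulo the printed citations until rung 0 closes; nothing
here is about HC.

THE SETTING (all ★).  `B` a Barsotti–Tate group over `Spec A`, `β : R → Hom B B` a ring action (`IsRingActionBT`), `a : ℕ → R` a family with
`a (n+1) ≡ a n`, `a n² ≡ a n (mod pⁿ)`; `ε := hβ.homOfCompatibleFamily a ha` (layers `β (a n)` ★ `homOfCompatibleFamily_app`) is an idempotent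
endomorphism (★ `homOfCompatibleFamily_idem`) commuting with every `β r` (★ `app_comm`); its fixed part `Bw := Fix ε` (★ `fixBTGroup`, given the rank
datum `hrank`) carries the restricted action `βw⁰ r := fixRestrict … (β r) …`, a ring action by ★ DEAL 1 `isRingActionBT_fixRestrict`.

THE PRINT.  [Tate1967] §2 (2.1)–(2.2) (the category of Barsotti–Tate groups; `End` acts layer-wise through `R ⁄ pⁿ`); [RapoportSmithlingZhang2020Diagonal]
§4.1 (p. 17): for an `𝓞_F`-action, `A[p^∞] = ∏_{w ∣ p} A[w^∞]`, the `w`-block being cut out by the idempotent `e_w ∈ 𝓞_F ⊗ ℤ_p` and carrying an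
action of `𝓞_{F,w}`; [HarrisTaylorAMS2001] §II.1 (p. 59) (Barsotti–Tate `𝓞_{F,w}`-modules).  WHAT IS TYPED: on the `n`-th layer of `Fix ε` the
`R`-action factors through `R ⁄ I_n`, `I_n := {b ∣ b · a_n ∈ (pⁿ)}` (§1: `ι_n ≫ β b = ι_n ≫ β (b a_n)` because `ε_n = β (a n)` fixes `Fix ε`); an
`s ∈ R` with a compatible «inverse family» `u` (`u n · s ≡ a n (mod pⁿ)`) acts invertibly on `Fix ε` with inverse the restricted family endomorphism of
`u` (§2); and if every `s ∉ w` has such a family and `w^{e n} a_n ⊆ (pⁿ)`, then every `s ∉ w` is a unit of `R ⁄ I_n`, so the universal property of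
the localisation (Mathlib `IsLocalization.lift`) gives CANONICAL ring maps `φ_n : R_w → R ⁄ I_n`, compatible in `n`, through which `R_w :=
Localization.AtPrime w` acts on `Fix ε` as a ring action extending `βw⁰` and killing `𝔪_w^{e n}` on the `n`-th layer (§3).

MAIN STATEMENTS.  §1 `app_fixRestrict_eq_of_sub_mul_mem_span_pow` (congruence mod `I_n`), **`app_fixRestrict_eq_one_of_mul_mem_span_pow`** (layers
killed); §2 **`exists_inverse_of_inverseFamily`**; §3 HEAD **`exists_isRingActionBT_localization`**.

## References
* [Tate1967] J. T. Tate, *p-divisible groups*, Proc. Conf. Local Fields (Driebergen, 1966), Springer (1967), §2 (2.1)–(2.2).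
* [RapoportSmithlingZhang2020Diagonal] M. Rapoport, B. Smithling, W. Zhang, *Arithmetic diagonal cycles on unitary Shimura varieties*, Compos. Math. 156
  (2020), §4.1 (p. 17).
* [HarrisTaylorAMS2001] M. Harris, R. Taylor, *The geometry and cohomology of some simple Shimura varieties*, Ann. of Math. Stud. 151 (2001), §II.1 (p. 59).
-/

set_option autoImplicit false

noncomputable section

universe u v

open CategoryTheory CategoryTheory.Limits AlgebraicGeometry MonoidalCategory CartesianMonoidalCategory
open scoped MonObj

namespace Literature.AlgebraicGeometry.GroupSchemes

namespace IsRingActionBT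

open BTGroup BTGroup.Hom

section CommRingBase

variable {A : Type u} [CommRing A] {p H : ℕ} {B : BTGroup (Spec (.of A)) p H} {R : Type v} [CommRing R] {β : R → BTGroup.Hom B B}
  (hβ : IsRingActionBT B β) (a : ℕ → R) (ha : ∀ n, a (n + 1) - a n ∈ Ideal.span {(p : R) ^ n})
  (ha2 : ∀ n, a n * a n - a n ∈ Ideal.span {(p : R) ^ n}) (h₁ : ℕ)
  (hrank : ∀ n (s : Spec (.of A)), ((hβ.homOfCompatibleFamily a ha).fixLayer n).hom.finrank s = p ^ (n * h₁))

/-! ## §0 Layer bookkeeping for `Fix ε` (all equalities typed on `(Fix ε).G n`, so that they rewrite inside `BTGroup.Hom` computations) -/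

/-- `ε := homOfCompatibleFamily a` commutes with every `β r`, layer-wise (`ε_n = β (a n)` and `R` is commutative). [cite: Tate1967, §2 (2.1)] -/
theorem app_comp_homOfCompatibleFamily_app (r : R) (n : ℕ) :
    (β r).app n ≫ (hβ.homOfCompatibleFamily a ha).app n = (hβ.homOfCompatibleFamily a ha).app n ≫ (β r).app n :=
  hβ.app_comm r (a n) n

/-- `(res φ)_n ≫ ι_n = ι_n ≫ φ_n` for the restriction to `Fix ε` of an endomorphism `φ` commuting with `ε` (★ `fixRestrict_comp_fixBTGroupι`, layer form).
[cite: Tate1967, §2 (2.1)] -/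
theorem fixRestrict_app_comp_fixBTGroupι_app {hε : ∀ n, (hβ.homOfCompatibleFamily a ha).app n ≫ (hβ.homOfCompatibleFamily a ha).app n =
      (hβ.homOfCompatibleFamily a ha).app n} (φ : BTGroup.Hom B B)
    (hφ : ∀ n, φ.app n ≫ (hβ.homOfCompatibleFamily a ha).app n = (hβ.homOfCompatibleFamily a ha).app n ≫ φ.app n) (n : ℕ) :
    (fixRestrict (hβ.homOfCompatibleFamily a ha) hε h₁ hrank (hβ.homOfCompatibleFamily a ha) hε h₁ hrank φ hφ).app n ≫
        ((hβ.homOfCompatibleFamily a ha).fixBTGroupι hε h₁ hrank).app n =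
      ((hβ.homOfCompatibleFamily a ha).fixBTGroupι hε h₁ hrank).app n ≫ φ.app n := by
  have h := congrArg (fun F => BTGroup.Hom.app F n)
    (fixRestrict_comp_fixBTGroupι (hβ.homOfCompatibleFamily a ha) hε h₁ hrank (hβ.homOfCompatibleFamily a ha) hε h₁ hrank φ hφ)
  simpa only [comp_app] using h

/-- `ι_n ≫ ε_n = ι_n` with `ε_n = β (a n)`: the family acts trivially on its fixed part. [cite: Tate1967, §2 (2.1)] -/
theorem fixBTGroupι_app_comp_app_family {hε : ∀ n, (hβ.homOfCompatibleFamily a ha).app n ≫ (hβ.homOfCompatibleFamily a ha).app n =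
      (hβ.homOfCompatibleFamily a ha).app n} (n : ℕ) :
    ((hβ.homOfCompatibleFamily a ha).fixBTGroupι hε h₁ hrank).app n ≫ (β (a n)).app n =
      ((hβ.homOfCompatibleFamily a ha).fixBTGroupι hε h₁ hrank).app n :=
  (hβ.homOfCompatibleFamily a ha).fixLayerι_comp n

/-- **On `Fix ε`, `β b` only depends on `b · a_n` at level `n`**: `ι_n ≫ β b = ι_n ≫ β (b · a n)` (`ι_n ≫ ε_n = ι_n`, `ε_n = β (a n)`, `β` multiplicative).
[cite: Tate1967, §2 (2.1)] -/
theorem fixBTGroupι_app_comp_app_eq {hε : ∀ n, (hβ.homOfCompatibleFamily a ha).app n ≫ (hβ.homOfCompatibleFamily a ha).app n =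
      (hβ.homOfCompatibleFamily a ha).app n} (b : R) (n : ℕ) :
    ((hβ.homOfCompatibleFamily a ha).fixBTGroupι hε h₁ hrank).app n ≫ (β b).app n =
      ((hβ.homOfCompatibleFamily a ha).fixBTGroupι hε h₁ hrank).app n ≫ (β (b * a n)).app n := by
  rw [hβ.map_mul, comp_app, ← Category.assoc, hβ.fixBTGroupι_app_comp_app_family a ha h₁ hrank n]

/-! ## §1 Layers killed `w`-adically: the action on `(Fix ε)_n` factors through `R ⁄ {b ∣ b a_n ∈ (pⁿ)}` -/

/-- **CONGRUENCE**: if `(b − b′) · a n ∈ (pⁿ)` then `βw⁰ b` and `βw⁰ b′` agree on the `n`-th layer of `Fix ε`. [cite: Tate1967, §2 (2.1)]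
[cite: RapoportSmithlingZhang2020Diagonal, §4.1 (p. 17)] -/
theorem app_fixRestrict_eq_of_sub_mul_mem_span_pow (n : ℕ) {b b' : R} (h : (b - b') * a n ∈ Ideal.span {(p : R) ^ n}) :
    (fixRestrict (hβ.homOfCompatibleFamily a ha) (hβ.homOfCompatibleFamily_idem a ha ha2) h₁ hrank (hβ.homOfCompatibleFamily a ha)
        (hβ.homOfCompatibleFamily_idem a ha ha2) h₁ hrank (β b) (hβ.app_comp_homOfCompatibleFamily_app a ha b)).app n =
      (fixRestrict (hβ.homOfCompatibleFamily a ha) (hβ.homOfCompatibleFamily_idem a ha ha2) h₁ hrank (hβ.homOfCompatibleFamily a ha)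
        (hβ.homOfCompatibleFamily_idem a ha ha2) h₁ hrank (β b') (hβ.app_comp_homOfCompatibleFamily_app a ha b')).app n := by
  haveI : Mono (((hβ.homOfCompatibleFamily a ha).fixBTGroupι (hβ.homOfCompatibleFamily_idem a ha ha2) h₁ hrank).app n) :=
    (hβ.homOfCompatibleFamily a ha).mono_fixLayerι n
  rw [← cancel_mono (((hβ.homOfCompatibleFamily a ha).fixBTGroupι (hβ.homOfCompatibleFamily_idem a ha ha2) h₁ hrank).app n),
    hβ.fixRestrict_app_comp_fixBTGroupι_app a ha h₁ hrank, hβ.fixRestrict_app_comp_fixBTGroupι_app a ha h₁ hrank,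
    hβ.fixBTGroupι_app_comp_app_eq a ha h₁ hrank b n, hβ.fixBTGroupι_app_comp_app_eq a ha h₁ hrank b' n,
    hβ.app_eq_app_of_sub_mem_span_pow (by rwa [← sub_mul])]

/-- **LAYERS KILLED**: if `b · a n ∈ (pⁿ)` (e.g. `b ∈ w^{e n}` for the CRT family at `w`, ★ (O-CRT)), then `βw⁰ b` is TRIVIAL on the `n`-th layer of
`Fix ε`. [cite: Tate1967, §2 (2.1)] [cite: RapoportSmithlingZhang2020Diagonal, §4.1 (p. 17)] -/
theorem app_fixRestrict_eq_one_of_mul_mem_span_pow (n : ℕ) (b : R) (h : b * a n ∈ Ideal.span {(p : R) ^ n}) :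
    (fixRestrict (hβ.homOfCompatibleFamily a ha) (hβ.homOfCompatibleFamily_idem a ha ha2) h₁ hrank (hβ.homOfCompatibleFamily a ha)
        (hβ.homOfCompatibleFamily_idem a ha ha2) h₁ hrank (β b) (hβ.app_comp_homOfCompatibleFamily_app a ha b)).app n =
      (letI := ((hβ.homOfCompatibleFamily a ha).fixBTGroup (hβ.homOfCompatibleFamily_idem a ha ha2) h₁ hrank).grpObj n; 1) := by
  letI := ((hβ.homOfCompatibleFamily a ha).fixBTGroup (hβ.homOfCompatibleFamily_idem a ha ha2) h₁ hrank).grpObj n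
  rw [hβ.app_fixRestrict_eq_of_sub_mul_mem_span_pow a ha ha2 h₁ hrank n (b' := 0) (by rwa [sub_zero])]
  letI := B.grpObj n
  haveI : Mono (((hβ.homOfCompatibleFamily a ha).fixBTGroupι (hβ.homOfCompatibleFamily_idem a ha ha2) h₁ hrank).app n) :=
    (hβ.homOfCompatibleFamily a ha).mono_fixLayerι n
  haveI : IsMonHom (((hβ.homOfCompatibleFamily a ha).fixBTGroupι (hβ.homOfCompatibleFamily_idem a ha ha2) h₁ hrank).app n) :=
    ((hβ.homOfCompatibleFamily a ha).fixBTGroupι (hβ.homOfCompatibleFamily_idem a ha ha2) h₁ hrank).isMonHom_app n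
  rw [← cancel_mono (((hβ.homOfCompatibleFamily a ha).fixBTGroupι (hβ.homOfCompatibleFamily_idem a ha ha2) h₁ hrank).app n),
    hβ.fixRestrict_app_comp_fixBTGroupι_app a ha h₁ hrank, hβ.app_zero n, MonObj.comp_one, MonObj.one_comp]

/-! ## §2 Units away from `w` act invertibly on the block -/

/-- **UNITS INVERTIBLE**: if `s ∈ R` admits a compatible «inverse family» `u` (`u (n+1) ≡ u n`, `u n · s ≡ a n (mod pⁿ)` — for `s ∉ w` and the CRT
family at `w` this is ★ (O-CRT) `exists_inverseFamily`), then `βw⁰ s` is INVERTIBLE on `Fix ε`, with a two-sided inverse commuting with every `βw⁰ r`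
(namely the restriction of the family endomorphism of `u`). [cite: Tate1967, §2 (2.1)] [cite: HarrisTaylorAMS2001, §II.1 (p. 59)] -/
theorem exists_inverse_of_inverseFamily (s : R)
    (hs : ∃ u : ℕ → R, (∀ n, u (n + 1) - u n ∈ Ideal.span {(p : R) ^ n}) ∧ ∀ n, u n * s - a n ∈ Ideal.span {(p : R) ^ n}) :
    ∃ v : BTGroup.Hom ((hβ.homOfCompatibleFamily a ha).fixBTGroup (hβ.homOfCompatibleFamily_idem a ha ha2) h₁ hrank)
        ((hβ.homOfCompatibleFamily a ha).fixBTGroup (hβ.homOfCompatibleFamily_idem a ha ha2) h₁ hrank),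
      (fixRestrict (hβ.homOfCompatibleFamily a ha) (hβ.homOfCompatibleFamily_idem a ha ha2) h₁ hrank (hβ.homOfCompatibleFamily a ha)
          (hβ.homOfCompatibleFamily_idem a ha ha2) h₁ hrank (β s) (hβ.app_comp_homOfCompatibleFamily_app a ha s)).comp v = Hom.id _ ∧
      v.comp (fixRestrict (hβ.homOfCompatibleFamily a ha) (hβ.homOfCompatibleFamily_idem a ha ha2) h₁ hrank (hβ.homOfCompatibleFamily a ha)
          (hβ.homOfCompatibleFamily_idem a ha ha2) h₁ hrank (β s) (hβ.app_comp_homOfCompatibleFamily_app a ha s)) = Hom.id _ ∧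
      ∀ r : R, v.comp (fixRestrict (hβ.homOfCompatibleFamily a ha) (hβ.homOfCompatibleFamily_idem a ha ha2) h₁ hrank (hβ.homOfCompatibleFamily a ha)
          (hβ.homOfCompatibleFamily_idem a ha ha2) h₁ hrank (β r) (hβ.app_comp_homOfCompatibleFamily_app a ha r)) =
        (fixRestrict (hβ.homOfCompatibleFamily a ha) (hβ.homOfCompatibleFamily_idem a ha ha2) h₁ hrank (hβ.homOfCompatibleFamily a ha)
          (hβ.homOfCompatibleFamily_idem a ha ha2) h₁ hrank (β r) (hβ.app_comp_homOfCompatibleFamily_app a ha r)).comp v := by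
  obtain ⟨u, hu, hus⟩ := hs
  have hUcomm : ∀ n, (hβ.homOfCompatibleFamily u hu).app n ≫ (hβ.homOfCompatibleFamily a ha).app n =
      (hβ.homOfCompatibleFamily a ha).app n ≫ (hβ.homOfCompatibleFamily u hu).app n := fun n => hβ.app_comm (u n) (a n) n
  haveI hmono : ∀ n, Mono (((hβ.homOfCompatibleFamily a ha).fixBTGroupι (hβ.homOfCompatibleFamily_idem a ha ha2) h₁ hrank).app n) :=
    fun n => (hβ.homOfCompatibleFamily a ha).mono_fixLayerι n
  refine ⟨fixRestrict (hβ.homOfCompatibleFamily a ha) (hβ.homOfCompatibleFamily_idem a ha ha2) h₁ hrank (hβ.homOfCompatibleFamily a ha)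
      (hβ.homOfCompatibleFamily_idem a ha ha2) h₁ hrank (hβ.homOfCompatibleFamily u hu) hUcomm, ?_, ?_, fun r => ?_⟩
  · refine Hom.ext fun n => ?_
    rw [← cancel_mono (((hβ.homOfCompatibleFamily a ha).fixBTGroupι (hβ.homOfCompatibleFamily_idem a ha ha2) h₁ hrank).app n),
      comp_app, id_app, Category.id_comp, Category.assoc, hβ.fixRestrict_app_comp_fixBTGroupι_app a ha h₁ hrank, ← Category.assoc,
      hβ.fixRestrict_app_comp_fixBTGroupι_app a ha h₁ hrank, Category.assoc, homOfCompatibleFamily_app, ← comp_app, ← hβ.map_mul,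
      hβ.app_eq_app_of_sub_mem_span_pow (hus n), hβ.fixBTGroupι_app_comp_app_family a ha h₁ hrank]
  · refine Hom.ext fun n => ?_
    have hsu : s * u n - a n ∈ Ideal.span {(p : R) ^ n} := by rw [mul_comm]; exact hus n
    rw [← cancel_mono (((hβ.homOfCompatibleFamily a ha).fixBTGroupι (hβ.homOfCompatibleFamily_idem a ha ha2) h₁ hrank).app n),
      comp_app, id_app, Category.id_comp, Category.assoc, hβ.fixRestrict_app_comp_fixBTGroupι_app a ha h₁ hrank, ← Category.assoc,
      hβ.fixRestrict_app_comp_fixBTGroupι_app a ha h₁ hrank, Category.assoc, homOfCompatibleFamily_app, ← comp_app, ← hβ.map_mul,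
      hβ.app_eq_app_of_sub_mem_span_pow hsu, hβ.fixBTGroupι_app_comp_app_family a ha h₁ hrank]
  · refine Hom.ext fun n => ?_
    have hL := hβ.fixRestrict_app_comp_fixBTGroupι_app a ha h₁ hrank (hε := hβ.homOfCompatibleFamily_idem a ha ha2) (β r)
      (hβ.app_comp_homOfCompatibleFamily_app a ha r) n
    have hU := hβ.fixRestrict_app_comp_fixBTGroupι_app a ha h₁ hrank (hε := hβ.homOfCompatibleFamily_idem a ha ha2)
      (hβ.homOfCompatibleFamily u hu) hUcomm n
    rw [← cancel_mono (((hβ.homOfCompatibleFamily a ha).fixBTGroupι (hβ.homOfCompatibleFamily_idem a ha ha2) h₁ hrank).app n),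
      comp_app, comp_app, Category.assoc, Category.assoc, hL, ← Category.assoc, hU, ← Category.assoc, hL, Category.assoc, Category.assoc,
      homOfCompatibleFamily_app, hβ.app_comm]

/-! ## §3 The action of the local ring `R_w` -/

include ha ha2 in
/-- **EXTENSION TO THE LOCAL RING (generic form).**  Let `β₀ : R → End(B₀)` be a ring action on a Barsotti–Tate group and `a : ℕ → R` a family
(`a (n+1) ≡ a n`, `a n² ≡ a n (mod pⁿ)`) such that at level `n` the action only depends on the class modulo `I_n := {b ∣ b a_n ∈ (pⁿ)}` (`hcong`;
for the `w`-block this is §1).  If every `s ∉ w` admits a compatible inverse family and `w^{e n} a_n ⊆ (pⁿ)`, then `β₀` EXTENDS to a ring action of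
`R_w := Localization.AtPrime w` agreeing with `β₀` on `R` and killing `𝔪_w^{e n}` on the `n`-th layer: every `s ∉ w` is a unit of `R ⁄ I_n`, so the
universal property of localisation gives canonical ring maps `φ_n : R_w → R ⁄ I_n`, compatible in `n`, and `(βw x)_n := (β₀ r)_n` for any `r` with
`r ≡ φ_n x`. [cite: Tate1967, §2 (2.1)–(2.2)] [cite: RapoportSmithlingZhang2020Diagonal, §4.1 (p. 17)] [cite: HarrisTaylorAMS2001, §II.1 (p. 59)] -/
theorem exists_isRingActionBT_localization_of_congr {h₀ : ℕ} {B₀ : BTGroup (Spec (.of A)) p h₀} {β₀ : R → BTGroup.Hom B₀ B₀}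
    (hβ₀ : IsRingActionBT B₀ β₀) (hcong : ∀ n (b b' : R), (b - b') * a n ∈ Ideal.span {(p : R) ^ n} → (β₀ b).app n = (β₀ b').app n)
    (w : Ideal R) [w.IsPrime]
    (hinv : ∀ s ∉ w, ∃ u : ℕ → R, (∀ n, u (n + 1) - u n ∈ Ideal.span {(p : R) ^ n}) ∧ ∀ n, u n * s - a n ∈ Ideal.span {(p : R) ^ n})
    (e : ℕ) (hkill : ∀ n, ∀ b ∈ w ^ (e * n), b * a n ∈ Ideal.span {(p : R) ^ n}) :
    ∃ βw : Localization.AtPrime w → BTGroup.Hom B₀ B₀, IsRingActionBT B₀ βw ∧ (∀ r : R, βw (algebraMap R (Localization.AtPrime w) r) = β₀ r) ∧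
      ∀ n, ∀ b ∈ (IsLocalRing.maximalIdeal (Localization.AtPrime w)) ^ (e * n), (βw b).app n = (letI := B₀.grpObj n; 1) := by
  -- §3.1 the ideals `I_n = {b ∣ b a_n ∈ (pⁿ)}` and the quotient maps `π_n`
  obtain ⟨I, hI⟩ : ∃ I : ℕ → Ideal R, ∀ n b, b ∈ I n ↔ b * a n ∈ Ideal.span {(p : R) ^ n} :=
    ⟨fun n => Submodule.comap (LinearMap.mulRight R (a n)) (Ideal.span {(p : R) ^ n}), fun n b => Iff.rfl⟩
  have hcongI : ∀ n {b b' : R}, Ideal.Quotient.mk (I n) b = Ideal.Quotient.mk (I n) b' → (β₀ b).app n = (β₀ b').app n :=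
    fun n b b' h => hcong n b b' ((hI n _).mp (Ideal.Quotient.eq.mp h))
  -- every `s ∉ w` is a unit modulo `I_n`
  have hunitI : ∀ n (y : w.primeCompl), IsUnit (Ideal.Quotient.mk (I n) (y : R)) := fun n y => by
    obtain ⟨u, -, hus⟩ := hinv y (Ideal.mem_primeCompl_iff.mp y.2)
    refine isUnit_iff_exists_inv'.mpr ⟨Ideal.Quotient.mk (I n) (u n), ?_⟩
    rw [← _root_.map_mul, ← _root_.map_one (Ideal.Quotient.mk (I n)), Ideal.Quotient.eq, hI]
    have : (u n * (y : R) - 1) * a n = (u n * (y : R) - a n) * a n + (a n * a n - a n) := by ring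
    rw [this]
    exact Ideal.add_mem _ (Ideal.mul_mem_right _ _ (hus n)) (ha2 n)
  -- the transitions `I_{n+1} ≤ I_n`
  have hIle : ∀ n, I (n + 1) ≤ I n := fun n b hb => by
    rw [hI] at hb ⊢
    have : b * a n = b * a (n + 1) - b * (a (n + 1) - a n) := by ring
    rw [this]
    exact Ideal.sub_mem _ (Ideal.span_singleton_le_span_singleton.mpr (pow_dvd_pow _ n.le_succ) hb) (Ideal.mul_mem_left _ _ (ha n))
  -- §3.2 the canonical maps `φ_n : R_w → R ⁄ I_n` (universal property) are compatible with the transitions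
  have hφcompat : ∀ n (x : Localization.AtPrime w),
      Ideal.Quotient.factor (hIle n) (IsLocalization.lift (M := w.primeCompl) (S := Localization.AtPrime w) (hunitI (n + 1)) x) =
        IsLocalization.lift (M := w.primeCompl) (S := Localization.AtPrime w) (hunitI n) x := fun n x => by
    have h : (Ideal.Quotient.factor (hIle n)).comp (IsLocalization.lift (M := w.primeCompl) (S := Localization.AtPrime w) (hunitI (n + 1))) =
        IsLocalization.lift (M := w.primeCompl) (S := Localization.AtPrime w) (hunitI n) := by
      refine IsLocalization.ringHom_ext (S := Localization.AtPrime w) w.primeCompl ?_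
      rw [RingHom.comp_assoc, IsLocalization.lift_comp, IsLocalization.lift_comp, Ideal.Quotient.factor_comp_mk]
    exact RingHom.congr_fun h x
  -- chosen numerators `lam n x` with `π_n (lam n x) = φ_n x`; KEY: any numerator gives the same layer map
  have hlam : ∀ n (x : Localization.AtPrime w), ∃ r : R, Ideal.Quotient.mk (I n) r = IsLocalization.lift (M := w.primeCompl) (S := Localization.AtPrime w) (hunitI n) x :=
    fun n x => Ideal.Quotient.mk_surjective _
  choose lam hlam using hlam
  have hkey : ∀ n x (r : R), Ideal.Quotient.mk (I n) r = IsLocalization.lift (M := w.primeCompl) (S := Localization.AtPrime w) (hunitI n) x →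
      (β₀ (lam n x)).app n = (β₀ r).app n := fun n x r hr => hcongI n (by rw [hlam, hr])
  have hlam_succ : ∀ n x, (β₀ (lam (n + 1) x)).app n = (β₀ (lam n x)).app n := fun n x =>
    hcongI n (by rw [hlam, ← Ideal.Quotient.factor_mk (hIle n), hlam, hφcompat])
  -- §3.3 the action and its properties (inherited from the ring maps `φ_n` and from `β₀`)
  refine ⟨fun x => ⟨fun n => (β₀ (lam n x)).app n, fun n => (β₀ (lam n x)).isMonHom_app n, fun n => by
      rw [← hlam_succ n x]; exact (β₀ (lam (n + 1) x)).incl_comp_app n⟩, ⟨?_, fun x y => ?_, fun x y n => ?_⟩, fun r => ?_, fun n b hb => ?_⟩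
  · -- `βw 1 = id`
    refine Hom.ext fun n => ?_
    change (β₀ (lam n 1)).app n = _
    rw [hkey n 1 1 (by rw [_root_.map_one, _root_.map_one]), hβ₀.map_one, id_app]
  · -- `βw (x * y) = βw y ∘ βw x`
    refine Hom.ext fun n => ?_
    change (β₀ (lam n (x * y))).app n = (β₀ (lam n y)).app n ≫ (β₀ (lam n x)).app n
    rw [hkey n (x * y) (lam n x * lam n y) (by rw [_root_.map_mul, _root_.map_mul, hlam, hlam]), hβ₀.map_mul, comp_app]
  · -- additivity on the `n`-th layer
    change (β₀ (lam n (x + y))).app n = lift ((β₀ (lam n x)).app n) ((β₀ (lam n y)).app n) ≫ _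
    rw [hkey n (x + y) (lam n x + lam n y) (by rw [_root_.map_add, _root_.map_add, hlam, hlam]), hβ₀.app_add]
  · -- `βw (r / 1) = β₀ r`
    refine Hom.ext fun n => ?_
    change (β₀ (lam n (algebraMap R (Localization.AtPrime w) r))).app n = _
    rw [hkey n _ r (by rw [IsLocalization.lift_eq])]
  · -- `𝔪_w^{e n}` kills the `n`-th layer
    letI := B₀.grpObj n
    change (β₀ (lam n b)).app n = 1
    rw [← Localization.AtPrime.map_eq_maximalIdeal, ← Ideal.map_pow] at hb
    obtain ⟨⟨⟨r, hr⟩, s⟩, hrs⟩ := (IsLocalization.mem_map_algebraMap_iff (M := w.primeCompl) (S := Localization.AtPrime w)).mp hb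
    have hφb : IsLocalization.lift (M := w.primeCompl) (S := Localization.AtPrime w) (hunitI n) b = 0 := by
      have h := congrArg (IsLocalization.lift (M := w.primeCompl) (S := Localization.AtPrime w) (hunitI n)) hrs
      rw [_root_.map_mul, IsLocalization.lift_eq, IsLocalization.lift_eq] at h
      have hr0 : Ideal.Quotient.mk (I n) r = 0 := Ideal.Quotient.eq_zero_iff_mem.mpr ((hI n r).mpr (hkill n r hr))
      rw [hr0] at h
      exact (IsUnit.mul_left_eq_zero (hunitI n s)).mp h
    rw [hkey n b 0 (by rw [_root_.map_zero, hφb]), hcong n 0 0 (by rw [sub_self, zero_mul]; exact Ideal.zero_mem _)]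
    exact hβ₀.app_zero n

end CommRingBase

/-! ### The head, over a field base (where ★ DEAL 1 `isRingActionBT_fixRestrict` lives; the K∕BT chain docks at a geometric point `Spec κ̄`) -/

section FieldBase

variable {k : Type u} [Field k] {p H : ℕ} {B : BTGroup (Spec (.of k)) p H} {R : Type v} [CommRing R] {β : R → BTGroup.Hom B B}
  (hβ : IsRingActionBT B β) (a : ℕ → R) (ha : ∀ n, a (n + 1) - a n ∈ Ideal.span {(p : R) ^ n})
  (ha2 : ∀ n, a n * a n - a n ∈ Ideal.span {(p : R) ^ n}) (h₁ : ℕ)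
  (hrank : ∀ n (s : Spec (.of k)), ((hβ.homOfCompatibleFamily a ha).fixLayer n).hom.finrank s = p ^ (n * h₁))

/-- **THE LOCAL RING AT `w` ACTS ON THE `w`-BLOCK (HEAD).**  Let `w` be a prime of `R` such that every `s ∉ w` admits a compatible inverse family
(`u n · s ≡ a n (mod pⁿ)`) and `w^{e n} · a n ⊆ (pⁿ)` for all `n` (★ (O-CRT) for the CRT family at `w ∣ p` in `𝓞_F`); base a field `k` (★ DEAL 1
`isRingActionBT_fixRestrict`; the chain docks at `Spec κ̄`).  Then the ring action `βw⁰`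
of `R` on `Fix ε` EXTENDS to a ring action `βw` of `R_w := Localization.AtPrime w` (`IsRingActionBT`), agreeing with `βw⁰` on `R`, and `𝔪_w^{e n}`
acts trivially on the `n`-th layer (§3 generic form applied with §1's congruence). [cite: Tate1967, §2 (2.1)–(2.2)]
[cite: RapoportSmithlingZhang2020Diagonal, §4.1 (p. 17)] [cite: HarrisTaylorAMS2001, §II.1 (p. 59)] -/
theorem exists_isRingActionBT_localization (w : Ideal R) [w.IsPrime]
    (hinv : ∀ s ∉ w, ∃ u : ℕ → R, (∀ n, u (n + 1) - u n ∈ Ideal.span {(p : R) ^ n}) ∧ ∀ n, u n * s - a n ∈ Ideal.span {(p : R) ^ n})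
    (e : ℕ) (hkill : ∀ n, ∀ b ∈ w ^ (e * n), b * a n ∈ Ideal.span {(p : R) ^ n}) :
    ∃ βw : Localization.AtPrime w →
        BTGroup.Hom ((hβ.homOfCompatibleFamily a ha).fixBTGroup (hβ.homOfCompatibleFamily_idem a ha ha2) h₁ hrank)
          ((hβ.homOfCompatibleFamily a ha).fixBTGroup (hβ.homOfCompatibleFamily_idem a ha ha2) h₁ hrank),
      IsRingActionBT ((hβ.homOfCompatibleFamily a ha).fixBTGroup (hβ.homOfCompatibleFamily_idem a ha ha2) h₁ hrank) βw ∧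
      (∀ r : R, βw (algebraMap R (Localization.AtPrime w) r) =
        fixRestrict (hβ.homOfCompatibleFamily a ha) (hβ.homOfCompatibleFamily_idem a ha ha2) h₁ hrank (hβ.homOfCompatibleFamily a ha)
          (hβ.homOfCompatibleFamily_idem a ha ha2) h₁ hrank (β r) (hβ.app_comp_homOfCompatibleFamily_app a ha r)) ∧
      ∀ n, ∀ b ∈ (IsLocalRing.maximalIdeal (Localization.AtPrime w)) ^ (e * n), (βw b).app n =
        (letI := ((hβ.homOfCompatibleFamily a ha).fixBTGroup (hβ.homOfCompatibleFamily_idem a ha ha2) h₁ hrank).grpObj n; 1) := by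
  refine exists_isRingActionBT_localization_of_congr a ha ha2
    (β₀ := fun r => fixRestrict (hβ.homOfCompatibleFamily a ha) (hβ.homOfCompatibleFamily_idem a ha ha2) h₁ hrank (hβ.homOfCompatibleFamily a ha)
      (hβ.homOfCompatibleFamily_idem a ha ha2) h₁ hrank (β r) (hβ.app_comp_homOfCompatibleFamily_app a ha r)) ?_ ?_ w hinv e hkill
  · exact isRingActionBT_fixRestrict (hβ.homOfCompatibleFamily a ha) (hβ.homOfCompatibleFamily_idem a ha ha2) h₁ hrank β hβ (hβ.app_comp_homOfCompatibleFamily_app a ha)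
  · intro n b b' h
    exact hβ.app_fixRestrict_eq_of_sub_mul_mem_span_pow a ha ha2 h₁ hrank n h

end FieldBase

end IsRingActionBT

end Literature.AlgebraicGeometry.GroupSchemes

end
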